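import Summits.BirchSwinnertonDyer.BirchSwinnertonDyer.Theorems.SylvesterTwoHeegnerIndexResidualsSharp
import Summits.BirchSwinnertonDyer.BirchSwinnertonDyer.Theorems.SylvesterTwoHeegnerIndexOneBitAbsorption
import HarnessLib

/-!
# Route `SylvesterTwoHeegnerIndex` (rung K7t): VARIANT J's stubs FACTOR in the kernel —
# (K3-4) ⟺ FIRST LAYER ∧ TAIL and (K3-7) ⟸ THEOREM C ∧ FIRST LAYER ∧ TAIL (each factor
# necessary); the first layer (THEOREM K2's typed conclusion, Kolyvagin at level `M = 1`) ALONE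
# settles every pair with `#Ш(E_p)[2^∞] · #Ш(E_{3p²})[2^∞] ≤ 4`

Cell `bsd-cm`, seat `bsd-cm-k7t-c2` (prover-bsd-cm-k7t-c2-g18-0; D-0074 hand «find: 19229»).
PARTITION (D-0054): CornerF at `p = 2` (B14/O12) × 𝒞_HSY (`E_p : x³ + y³ = p`, `p ≡ 4, 7 (9)`
prime, `3 ∉ 𝔽_p^{×3}`) × `p = 2` — states-the-residual-of, FINER than `SylvesterTwoResidualsSharp`
(p587423): closes no cell and no item; moves no label; BSD is not claimed for any curve. Kernel
record `--supports stmt-BirchSwinnertonDyer-19229` (CONDITIONAL theorems; composition only).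

THE FINDING. Write `c_B := #Ш(B)[2^∞]`, `c_A := #Ш(A)[2^∞]` (`B ≅ E_p`, `A ≅ E_{3p²}` globally
minimal), `s_X := ord₂ c_X`, `v := ord₂(#Ш_an(B)·#Ш_an(A))` (`= 2m(p)` on `p ≡ 4 (9)`,
`= 2m(p) − 2` on `p ≡ 7 (9)` by Hu–Shu–Yin's display). Stub (K3-4) of crux 19804 is the typed
coupled bound `s_B + s_A ≤ v` (`CoupledUpperBoundAtTwoFourModNine`, K3R p563747). Its `v = 0`
slice is the typed conclusion of the cell's **THEOREM K2** (memo two §57.4; refereed PASS, desk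
(M) g59 `referee/REFEREE-ROADK-K2-G59.md`, flag (h3) discharged g60; conditional on
`PublishedFactsTwoPlus` only): «`m(p) = 0 ⇒ Ш(E_p)[2^∞] = Ш(E_{3p²})[2^∞] = 0`», i.e. **FIRST
LAYER: `v = 0 ⇒ c_B = c_A = 1`** — Kolyvagin's argument at level `M = 1` only (Gross 1991 Prop.
2.3 / §10 transposed to the coupled pair: one Čebotarev class, one local duality; NO induction
over levels `2^M`, NO `𝒪₂/2^M` Cassels–Tate bookkeeping). Granted `PublishedFactsTwoPlus` (19724),
this file proves by composition that the first layer is NECESSARY for (K3-4) and SUFFICIENT for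
its conclusion AT EVERY PAIR WITH `c_B · c_A ≤ 4` (`v = 0` is the layer; otherwise `v = 2n ≥ 2` by
the display's evenness while `c_B · c_A ≤ 4` forces `s_B + s_A ≤ 2`; no Cassels–Tate input), hence
**(K3-4) ⟺ FIRST LAYER ∧ TAIL**, the tail being (K3-4)'s own conclusion on the pairs with
`4 < c_B · c_A` — granted Cassels–Tate squareness, on `16 ≤ c_B · c_A`, i.e. `s_B + s_A ≥ 4`: the
census's `(ℤ/2)⁴`, `(ℤ/4)²` and `(ℤ/2)² × (ℤ/2)²` strata (`p = 18913`, `562399`, `1054327`, …)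
and nothing else. On `p ≡ 7 (9)` a THIRD necessary factor enters, THEOREM C (crux 19802 typed —
exactly `v ≥ 0` there; necessity is p587423's), and with it the same sufficiency holds; the
`p ≡ 7 (9)` first layer is memo §67 COROLLARY K2(7)'s shape, a paper CANDIDATE (desk (M-K3-7)
pending). Last, the hand item 19229 BY NAME from `PublishedFactsTwoPlus` + THEOREM C + the two
first layers + the two tails.

WHY RECORD IT (seat reading; the planner's pen decides): the uncommissioned XL Euler-system
programme behind (K3-4)/(K3-7) has a natural FIRST MILESTONE, isolated on paper and separately
refereed — the `M = 1` layer — which in the kernel is not merely «the `m = 0` slice»: it DISCHARGES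
the coupled bound on the whole locus `c_B · c_A ≤ 4` (the `[1,1,2]` rows with `2`-trivial partner,
the `𝒱₀(B)` rows with `c_A = 4`), leaving to K3's induction exactly the strata `s_B + s_A ≥ 4`.

HONEST READING. Composition; every hypothesis DISPLAYED (first layers and tails are section
binders written out in full; no definition, no new named fact); nothing decided for any `p`;
B14 = O12 OPEN AS A CLASS; THEOREMS K2 / K3 / C are refereed PAPER theorems of the cell, K3\* and
K2(7) paper candidates, all kernel-OPEN; nothing here ranks paper difficulty. «find: 19229»:
NOT FOUND as a kernel theorem (18th gen).
References: Hu–Shu–Yin, JLMS 100 (2019) Thm. 1.4, Cor. 4.4, (bsd) p. 12; Gross / McCallum, LMS LN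
153 (1991) Prop. 2.3, §10 / Thm. 5.4; Kolyvagin (1990) Thm. A; Silverman AEC X.4.14; cell memos.
-/

set_option autoImplicit false
set_option linter.dupNamespace false

namespace Summit.BirchSwinnertonDyer.BirchSwinnertonDyer.Theorems.SylvesterTwoFirstLayerSplit

open WeierstrassCurve Literature.NumberTheory.EllipticCurves HuShuYin2019
open Summit.BirchSwinnertonDyer.Rank1Residual Summit.BirchSwinnertonDyer.BirchSwinnertonDyer
  Theses.SylvesterTwoHeegnerIndex Theorems Theorems.SylvesterTwoCoupledUpperBound

/-! ## §0 Two counting lemmas on finite `2`-primary components -/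

/-- A finite `2`-primary component whose order has `ord₂ = 0` is trivial. [folklore] -/
theorem card_primaryComponent_eq_one_of_padicValNat_eq_zero {G : Type*} [AddCommGroup G]
    [Finite (AddCommGroup.primaryComponent G 2)]
    (h : padicValNat 2 (Nat.card (AddCommGroup.primaryComponent G 2)) = 0) :
    Nat.card (AddCommGroup.primaryComponent G 2) = 1 := by
  haveI : Fact (2 : ℕ).Prime := ⟨Nat.prime_two⟩
  obtain ⟨k, hk⟩ :=
    Literature.NumberTheory.EllipticCurves.exists_natCard_primaryComponent_eq_pow (A := G) 2
  rw [hk, padicValNat.prime_pow] at h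
  rw [hk, h, pow_zero]

/-- Two finite `2`-primary components with `# · # ≤ 4` have `ord₂ # + ord₂ # ≤ 2`. [folklore] -/
theorem padicValNat_add_le_two_of_card_mul_le_four {G H : Type*} [AddCommGroup G]
    [AddCommGroup H] [Finite (AddCommGroup.primaryComponent G 2)]
    [Finite (AddCommGroup.primaryComponent H 2)]
    (hle : Nat.card (AddCommGroup.primaryComponent G 2) *
        Nat.card (AddCommGroup.primaryComponent H 2) ≤ 4) :
    padicValNat 2 (Nat.card (AddCommGroup.primaryComponent G 2)) +
        padicValNat 2 (Nat.card (AddCommGroup.primaryComponent H 2)) ≤ 2 := by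
  haveI : Fact (2 : ℕ).Prime := ⟨Nat.prime_two⟩
  obtain ⟨k, hk⟩ :=
    Literature.NumberTheory.EllipticCurves.exists_natCard_primaryComponent_eq_pow (A := G) 2
  obtain ⟨l, hl⟩ :=
    Literature.NumberTheory.EllipticCurves.exists_natCard_primaryComponent_eq_pow (A := H) 2
  rw [hk, hl, padicValNat.prime_pow, padicValNat.prime_pow]
  rw [hk, hl, ← pow_add, show (4 : ℕ) = 2 ^ 2 by norm_num] at hle
  exact (Nat.pow_le_pow_iff_right (by norm_num : 1 < 2)).mp hle

/-! ## §1 Per-pair cores (both residue classes at once) -/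

/-- **Necessity core.** If the coupled bound holds at a pair (K3R's `∃ qB qA, …` shape) and
`ord₂(qB·qA) = 0` for the (unique) rational analytic orders, both `2`-parts are trivial (given
finiteness of `Ш(B)`, `Ш(A)[2^∞]`). [cite: HuShuYin2019, display (bsd) p. 12] -/
theorem cards_eq_one_of_pairBound_of_padicValRat_eq_zero {A B : WeierstrassCurve ℚ}
    (hfinB : Finite B.sha) (hfinA : Finite (AddCommGroup.primaryComponent A.sha 2))
    (hK : ∃ qB qA : ℚ, shaAn B = (qB : ℂ) ∧ shaAn A = (qA : ℂ) ∧ qB * qA ≠ 0 ∧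
      (padicValNat 2 (Nat.card (AddCommGroup.primaryComponent B.sha 2)) : ℤ) +
          (padicValNat 2 (Nat.card (AddCommGroup.primaryComponent A.sha 2)) : ℤ) ≤
        padicValRat 2 (qB * qA))
    {qB qA : ℚ} (hqB : shaAn B = (qB : ℂ)) (hqA : shaAn A = (qA : ℂ))
    (h0 : padicValRat 2 (qB * qA) = 0) :
    Nat.card (AddCommGroup.primaryComponent B.sha 2) = 1 ∧
      Nat.card (AddCommGroup.primaryComponent A.sha 2) = 1 := by
  obtain ⟨qB', qA', hqB', hqA', -, hle⟩ := hK
  have eB : qB' = qB := by exact_mod_cast hqB'.symm.trans hqB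
  have eA : qA' = qA := by exact_mod_cast hqA'.symm.trans hqA
  subst eB eA
  rw [h0] at hle
  have hB0 : padicValNat 2 (Nat.card (AddCommGroup.primaryComponent B.sha 2)) = 0 := by omega
  have hA0 : padicValNat 2 (Nat.card (AddCommGroup.primaryComponent A.sha 2)) = 0 := by omega
  exact ⟨card_primaryComponent_eq_one_of_padicValNat_eq_zero hB0,
    card_primaryComponent_eq_one_of_padicValNat_eq_zero hA0⟩

/-- **Sufficiency core on the small locus.** At a pair with rational analytic orders,
`ord₂(qB·qA) = 2n` (`n : ℕ`), the FIRST LAYER at the pair and `#Ш(B)[2^∞]·#Ш(A)[2^∞] ≤ 4` give the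
coupled bound there: `n = 0` is the layer, `n ≥ 1` is `s_B + s_A ≤ 2 ≤ 2n`.
[cite: HuShuYin2019, display (bsd) p. 12] [cite: GrossLMS1991, Prop. 2.3] -/
theorem pairBound_of_even_rhs_of_firstLayerAt_of_card_mul_le_four {A B : WeierstrassCurve ℚ}
    [Finite (AddCommGroup.primaryComponent B.sha 2)]
    [Finite (AddCommGroup.primaryComponent A.sha 2)]
    {qB qA : ℚ} (hqB : shaAn B = (qB : ℂ)) (hqA : shaAn A = (qA : ℂ)) (hne : qB * qA ≠ 0)
    {n : ℕ} (hn : padicValRat 2 (qB * qA) = 2 * n)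
    (hK2 : padicValRat 2 (qB * qA) = 0 →
      Nat.card (AddCommGroup.primaryComponent B.sha 2) = 1 ∧
        Nat.card (AddCommGroup.primaryComponent A.sha 2) = 1)
    (hle : Nat.card (AddCommGroup.primaryComponent B.sha 2) *
        Nat.card (AddCommGroup.primaryComponent A.sha 2) ≤ 4) :
    ∃ qB qA : ℚ, shaAn B = (qB : ℂ) ∧ shaAn A = (qA : ℂ) ∧ qB * qA ≠ 0 ∧
      (padicValNat 2 (Nat.card (AddCommGroup.primaryComponent B.sha 2)) : ℤ) +
          (padicValNat 2 (Nat.card (AddCommGroup.primaryComponent A.sha 2)) : ℤ) ≤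
        padicValRat 2 (qB * qA) := by
  refine ⟨qB, qA, hqB, hqA, hne, ?_⟩
  rcases Nat.eq_zero_or_pos n with rfl | hpos
  · have h0 : padicValRat 2 (qB * qA) = 0 := by rw [hn]; simp
    obtain ⟨hB1, hA1⟩ := hK2 h0
    rw [hB1, hA1, h0]
    simp
  · have h2 := padicValNat_add_le_two_of_card_mul_le_four (G := B.sha) (H := A.sha) hle
    rw [hn]
    omega

/-! ## §2 `p ≡ 4 (mod 9)`: (K3-4) ⟺ FIRST LAYER ∧ TAIL -/

section Split

variable (hF : PublishedFactsTwoPlus)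

include hF in
/-- **The first layer is NECESSARY for (K3-4)**: granted `PublishedFactsTwoPlus`, K3 typed implies
THEOREM K2's typed conclusion in analytic pair form — for every `p ≡ 4 (9)` pair,
`ord₂(#Ш_an(B)·#Ш_an(A)) = 0 ⇒ #Ш(B)[2^∞] = #Ш(A)[2^∞] = 1`.
[cite: HuShuYin2019, Cor. 4.4 and (bsd) p. 12] [cite: GrossLMS1991, Prop. 2.3] -/
theorem firstLayerFour_of_coupledUpperBoundFour (hK4 : CoupledUpperBoundAtTwoFourModNine) :
    ∀ (p : ℕ), p.Prime → p % 9 = 4 → (¬ ∃ x : ZMod p, x ^ 3 = 3) →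
      ∀ (A B : WeierstrassCurve ℚ) [A.IsElliptic] [A.IsGloballyMinimal] [B.IsElliptic]
        [B.IsGloballyMinimal], (∃ C : VariableChange ℚ, C • B = cubeSumCurve (p : ℚ)) →
        (∃ C : VariableChange ℚ, C • A = cubeSumCurve (3 * (p : ℚ) ^ 2)) →
        ∀ (qB qA : ℚ), shaAn B = (qB : ℂ) → shaAn A = (qA : ℂ) → qB * qA ≠ 0 →
          padicValRat 2 (qB * qA) = 0 →
          Nat.card (AddCommGroup.primaryComponent B.sha 2) = 1 ∧
            Nat.card (AddCommGroup.primaryComponent A.sha 2) = 1 := by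
  intro p hp h4 h3 A B _ _ _ _ hB hA qB qA hqB hqA _ h0
  obtain ⟨⟨hHSY, hCM0, hmod, -⟩, -⟩ := id hF
  obtain ⟨hfin, hfinA, -⟩ :=
    SylvesterTwoUpper.pair_shaAn_two hHSY hCM0 hmod hp (Or.inl h4) h3 A B hB hA
  exact cards_eq_one_of_pairBound_of_padicValRat_eq_zero hfin hfinA (hK4 p hp h4 h3 A B hB hA)
    hqB hqA h0

/- DISPLAYED BINDERS (hypotheses, never asserted): `hK2₄` = the `p ≡ 4 (9)` FIRST LAYER (THEOREM
K2's typed conclusion, memo two §57.4, refereed g59/g60: pair unit ⇒ pair `2`-trivial); `ht₄` =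
the `p ≡ 4 (9)` TAIL ((K3-4)'s own conclusion on the pairs with `4 < #Ш(B)[2^∞]·#Ш(A)[2^∞]`). -/
variable
  (hK2₄ : ∀ (p : ℕ), p.Prime → p % 9 = 4 → (¬ ∃ x : ZMod p, x ^ 3 = 3) →
      ∀ (A B : WeierstrassCurve ℚ) [A.IsElliptic] [A.IsGloballyMinimal] [B.IsElliptic]
        [B.IsGloballyMinimal], (∃ C : VariableChange ℚ, C • B = cubeSumCurve (p : ℚ)) →
        (∃ C : VariableChange ℚ, C • A = cubeSumCurve (3 * (p : ℚ) ^ 2)) →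
        ∀ (qB qA : ℚ), shaAn B = (qB : ℂ) → shaAn A = (qA : ℂ) → qB * qA ≠ 0 →
          padicValRat 2 (qB * qA) = 0 →
          Nat.card (AddCommGroup.primaryComponent B.sha 2) = 1 ∧
            Nat.card (AddCommGroup.primaryComponent A.sha 2) = 1)
  (ht₄ : ∀ (p : ℕ), p.Prime → p % 9 = 4 → (¬ ∃ x : ZMod p, x ^ 3 = 3) →
      ∀ (A B : WeierstrassCurve ℚ) [A.IsElliptic] [A.IsGloballyMinimal] [B.IsElliptic]
        [B.IsGloballyMinimal], (∃ C : VariableChange ℚ, C • B = cubeSumCurve (p : ℚ)) →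
        (∃ C : VariableChange ℚ, C • A = cubeSumCurve (3 * (p : ℚ) ^ 2)) →
        4 < Nat.card (AddCommGroup.primaryComponent B.sha 2) *
            Nat.card (AddCommGroup.primaryComponent A.sha 2) →
        ∃ qB qA : ℚ, shaAn B = (qB : ℂ) ∧ shaAn A = (qA : ℂ) ∧ qB * qA ≠ 0 ∧
          (padicValNat 2 (Nat.card (AddCommGroup.primaryComponent B.sha 2)) : ℤ) +
              (padicValNat 2 (Nat.card (AddCommGroup.primaryComponent A.sha 2)) : ℤ) ≤
            padicValRat 2 (qB * qA))

include hF hK2₄ in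
/-- **The first layer is SUFFICIENT for (K3-4)'s conclusion at every `p ≡ 4 (9)` pair with
`#Ш(B)[2^∞]·#Ш(A)[2^∞] ≤ 4`**, granted `PublishedFactsTwoPlus` (the display gives
`ord₂(qB·qA) = 2n`; `n = 0` is the layer, `n ≥ 1` is `s_B + s_A ≤ 2 ≤ 2n`). No Cassels–Tate input.
[cite: HuShuYin2019, display (bsd) p. 12] [cite: GrossLMS1991, Prop. 2.3] -/
theorem coupledUpperBoundFourAt_of_firstLayer_of_card_mul_le_four {p : ℕ} (hp : p.Prime)
    (h4 : p % 9 = 4) (h3 : ¬ ∃ x : ZMod p, x ^ 3 = 3) (A B : WeierstrassCurve ℚ) [A.IsElliptic]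
    [A.IsGloballyMinimal] [B.IsElliptic] [B.IsGloballyMinimal]
    (hB : ∃ C : VariableChange ℚ, C • B = cubeSumCurve (p : ℚ))
    (hA : ∃ C : VariableChange ℚ, C • A = cubeSumCurve (3 * (p : ℚ) ^ 2))
    (hle : Nat.card (AddCommGroup.primaryComponent B.sha 2) *
        Nat.card (AddCommGroup.primaryComponent A.sha 2) ≤ 4) :
    ∃ qB qA : ℚ, shaAn B = (qB : ℂ) ∧ shaAn A = (qA : ℂ) ∧ qB * qA ≠ 0 ∧
      (padicValNat 2 (Nat.card (AddCommGroup.primaryComponent B.sha 2)) : ℤ) +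
          (padicValNat 2 (Nat.card (AddCommGroup.primaryComponent A.sha 2)) : ℤ) ≤
        padicValRat 2 (qB * qA) := by
  obtain ⟨hfinB, hfinA⟩ := finite_sha_two_pair hF hp h4 h3 A B hB hA
  obtain ⟨qB, qA, hqB, hqA, hne, n, hn⟩ := even_rhs_of_facts hF hp h4 h3 A B hB hA
  exact pairBound_of_even_rhs_of_firstLayerAt_of_card_mul_le_four hqB hqA hne hn
    (hK2₄ p hp h4 h3 A B hB hA qB qA hqB hqA hne) hle

include hF hK2₄ ht₄ in
/-- **(K3-4) from FIRST LAYER + TAIL**, granted `PublishedFactsTwoPlus`.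
[cite: HuShuYin2019, display (bsd) p. 12] [cite: McCallumLMS1991, Thm. 5.4] -/
theorem coupledUpperBoundFour_of_firstLayer_of_tail : CoupledUpperBoundAtTwoFourModNine := by
  intro p hp h4 h3 A B _ _ _ _ hB hA
  by_cases hle : Nat.card (AddCommGroup.primaryComponent B.sha 2) *
      Nat.card (AddCommGroup.primaryComponent A.sha 2) ≤ 4
  · exact coupledUpperBoundFourAt_of_firstLayer_of_card_mul_le_four hF hK2₄ hp h4 h3 A B hB hA hle
  · exact ht₄ p hp h4 h3 A B hB hA (not_le.mp hle)

include hF in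
/-- **(K3-4) ⟺ FIRST LAYER ∧ TAIL**, granted `PublishedFactsTwoPlus`: VARIANT J's stub factors as
THEOREM K2's typed conclusion (Kolyvagin at `M = 1` for the pair; refereed paper theorem) AND K3's
conclusion on the pairs with `4 < #Ш(B)[2^∞]·#Ш(A)[2^∞]` (the induction over levels `2^M`); both
displayed, both kernel-OPEN. [cite: HuShuYin2019, Cor. 4.4 and (bsd) p. 12]
[cite: GrossLMS1991, Prop. 2.3] [cite: McCallumLMS1991, Thm. 5.4] -/
theorem coupledUpperBoundFour_iff_firstLayer_and_tail :
    CoupledUpperBoundAtTwoFourModNine ↔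
      ((∀ (p : ℕ), p.Prime → p % 9 = 4 → (¬ ∃ x : ZMod p, x ^ 3 = 3) →
        ∀ (A B : WeierstrassCurve ℚ) [A.IsElliptic] [A.IsGloballyMinimal] [B.IsElliptic]
          [B.IsGloballyMinimal], (∃ C : VariableChange ℚ, C • B = cubeSumCurve (p : ℚ)) →
          (∃ C : VariableChange ℚ, C • A = cubeSumCurve (3 * (p : ℚ) ^ 2)) →
          ∀ (qB qA : ℚ), shaAn B = (qB : ℂ) → shaAn A = (qA : ℂ) → qB * qA ≠ 0 →
            padicValRat 2 (qB * qA) = 0 →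
            Nat.card (AddCommGroup.primaryComponent B.sha 2) = 1 ∧
              Nat.card (AddCommGroup.primaryComponent A.sha 2) = 1) ∧
      (∀ (p : ℕ), p.Prime → p % 9 = 4 → (¬ ∃ x : ZMod p, x ^ 3 = 3) →
        ∀ (A B : WeierstrassCurve ℚ) [A.IsElliptic] [A.IsGloballyMinimal] [B.IsElliptic]
          [B.IsGloballyMinimal], (∃ C : VariableChange ℚ, C • B = cubeSumCurve (p : ℚ)) →
          (∃ C : VariableChange ℚ, C • A = cubeSumCurve (3 * (p : ℚ) ^ 2)) →
          4 < Nat.card (AddCommGroup.primaryComponent B.sha 2) *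
              Nat.card (AddCommGroup.primaryComponent A.sha 2) →
          ∃ qB qA : ℚ, shaAn B = (qB : ℂ) ∧ shaAn A = (qA : ℂ) ∧ qB * qA ≠ 0 ∧
            (padicValNat 2 (Nat.card (AddCommGroup.primaryComponent B.sha 2)) : ℤ) +
                (padicValNat 2 (Nat.card (AddCommGroup.primaryComponent A.sha 2)) : ℤ) ≤
              padicValRat 2 (qB * qA))) :=
  ⟨fun hK4 => ⟨firstLayerFour_of_coupledUpperBoundFour hF hK4,
      fun p hp h4 h3 A B _ _ _ _ hB hA _ => hK4 p hp h4 h3 A B hB hA⟩,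
    fun h => coupledUpperBoundFour_of_firstLayer_of_tail hF h.1 h.2⟩

include hF hK2₄ in
/-- **Granted Cassels–Tate, the tail starts at `16`**: `s_B`, `s_A` are then even
(`SylvesterTwoOneBit.even_pairSha`), so `#Ш(B)[2^∞]·#Ш(A)[2^∞] ∈ {1, 4, 16, …}` and the first
layer plus K3's conclusion on the pairs with `16 ≤ # · #` (`s_B + s_A ≥ 4`) give (K3-4).
[cite: SilvermanAEC2009, Thm. X.4.14] [cite: HuShuYin2019, display (bsd) p. 12] -/
theorem coupledUpperBoundFour_of_casselsTate_of_firstLayer_of_tailSixteen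
    (hCT : WeierstrassCurve.exists_casselsTate_pairing (K := ℚ))
    (ht16 : ∀ (p : ℕ), p.Prime → p % 9 = 4 → (¬ ∃ x : ZMod p, x ^ 3 = 3) →
      ∀ (A B : WeierstrassCurve ℚ) [A.IsElliptic] [A.IsGloballyMinimal] [B.IsElliptic]
        [B.IsGloballyMinimal], (∃ C : VariableChange ℚ, C • B = cubeSumCurve (p : ℚ)) →
        (∃ C : VariableChange ℚ, C • A = cubeSumCurve (3 * (p : ℚ) ^ 2)) →
        16 ≤ Nat.card (AddCommGroup.primaryComponent B.sha 2) *
            Nat.card (AddCommGroup.primaryComponent A.sha 2) →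
        ∃ qB qA : ℚ, shaAn B = (qB : ℂ) ∧ shaAn A = (qA : ℂ) ∧ qB * qA ≠ 0 ∧
          (padicValNat 2 (Nat.card (AddCommGroup.primaryComponent B.sha 2)) : ℤ) +
              (padicValNat 2 (Nat.card (AddCommGroup.primaryComponent A.sha 2)) : ℤ) ≤
            padicValRat 2 (qB * qA)) :
    CoupledUpperBoundAtTwoFourModNine := by
  refine coupledUpperBoundFour_of_firstLayer_of_tail hF hK2₄ ?_
  intro p hp h4 h3 A B _ _ _ _ hB hA hlt
  haveI : Fact (2 : ℕ).Prime := ⟨Nat.prime_two⟩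
  obtain ⟨hfinB, hfinA⟩ := finite_sha_two_pair hF hp h4 h3 A B hB hA
  obtain ⟨⟨hHSY, hCM0, hmod, -⟩, -⟩ := id hF
  have hev := SylvesterTwoOneBit.even_pairSha hHSY hCM0 hmod hCT hp (Or.inl h4) h3 A B hB hA
  refine ht16 p hp h4 h3 A B hB hA ?_
  obtain ⟨k, hk⟩ :=
    Literature.NumberTheory.EllipticCurves.exists_natCard_primaryComponent_eq_pow (A := B.sha) 2
  obtain ⟨l, hl⟩ :=
    Literature.NumberTheory.EllipticCurves.exists_natCard_primaryComponent_eq_pow (A := A.sha) 2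
  rw [hk, hl, padicValNat.prime_pow, padicValNat.prime_pow] at hev
  rw [hk, hl, ← pow_add] at hlt ⊢
  have h2 : 2 < k + l := (Nat.pow_lt_pow_iff_right (by norm_num : 1 < 2)).mp (by simpa using hlt)
  obtain ⟨t, ht⟩ := hev
  calc (16 : ℕ) = 2 ^ 4 := by norm_num
    _ ≤ 2 ^ (k + l) := Nat.pow_le_pow_right (by norm_num) (by omega)

/-! ## §3 `p ≡ 7 (mod 9)`: (K3-7) ⟸ THEOREM C ∧ FIRST LAYER ∧ TAIL, each factor necessary -/

include hF in
/-- **The `p ≡ 7 (9)` first layer is NECESSARY for (K3-7)**, granted `PublishedFactsTwoPlus`: the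
typed K3\* implies «`ord₂(#Ш_an(B)·#Ш_an(A)) = 0 ⇒` both `2`-parts trivial» (memo §67 COROLLARY
K2(7)'s shape, `m(p) = 1`; paper CANDIDATE). THEOREM C is necessary too (p587423's
`…ResidualsSharp.hsyPointTwoDivisibleSevenModNine_of_factsPlus_of_coupledUpperBoundSeven`), and
the tail is a restriction. [cite: HuShuYin2019, Cor. 4.4 and (bsd) p. 12]
[cite: GrossLMS1991, Prop. 2.3] -/
theorem firstLayerSeven_of_coupledUpperBoundSeven (hK7 : CoupledUpperBoundAtTwoSevenModNine) :
    ∀ (p : ℕ), p.Prime → p % 9 = 7 → (¬ ∃ x : ZMod p, x ^ 3 = 3) →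
      ∀ (A B : WeierstrassCurve ℚ) [A.IsElliptic] [A.IsGloballyMinimal] [B.IsElliptic]
        [B.IsGloballyMinimal], (∃ C : VariableChange ℚ, C • B = cubeSumCurve (p : ℚ)) →
        (∃ C : VariableChange ℚ, C • A = cubeSumCurve (3 * (p : ℚ) ^ 2)) →
        ∀ (qB qA : ℚ), shaAn B = (qB : ℂ) → shaAn A = (qA : ℂ) → qB * qA ≠ 0 →
          padicValRat 2 (qB * qA) = 0 →
          Nat.card (AddCommGroup.primaryComponent B.sha 2) = 1 ∧
            Nat.card (AddCommGroup.primaryComponent A.sha 2) = 1 := by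
  intro p hp h7 h3 A B _ _ _ _ hB hA qB qA hqB hqA _ h0
  obtain ⟨⟨hHSY, hCM0, hmod, -⟩, -⟩ := id hF
  obtain ⟨hfin, hfinA, -⟩ :=
    SylvesterTwoUpper.pair_shaAn_two hHSY hCM0 hmod hp (Or.inr h7) h3 A B hB hA
  exact cards_eq_one_of_pairBound_of_padicValRat_eq_zero hfin hfinA (hK7 p hp h7 h3 A B hB hA)
    hqB hqA h0

/- DISPLAYED BINDERS (hypotheses, never asserted): `hK2₇` = the `p ≡ 7 (9)` FIRST LAYER (memo §67
COROLLARY K2(7): `m(p) = 1 ⇒` pair `2`-trivial; paper CANDIDATE, desk (M-K3-7) pending); `ht₇` =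
the `p ≡ 7 (9)` TAIL ((K3-7)'s own conclusion on the pairs with `4 < #Ш(B)[2^∞]·#Ш(A)[2^∞]`). -/
variable
  (hK2₇ : ∀ (p : ℕ), p.Prime → p % 9 = 7 → (¬ ∃ x : ZMod p, x ^ 3 = 3) →
      ∀ (A B : WeierstrassCurve ℚ) [A.IsElliptic] [A.IsGloballyMinimal] [B.IsElliptic]
        [B.IsGloballyMinimal], (∃ C : VariableChange ℚ, C • B = cubeSumCurve (p : ℚ)) →
        (∃ C : VariableChange ℚ, C • A = cubeSumCurve (3 * (p : ℚ) ^ 2)) →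
        ∀ (qB qA : ℚ), shaAn B = (qB : ℂ) → shaAn A = (qA : ℂ) → qB * qA ≠ 0 →
          padicValRat 2 (qB * qA) = 0 →
          Nat.card (AddCommGroup.primaryComponent B.sha 2) = 1 ∧
            Nat.card (AddCommGroup.primaryComponent A.sha 2) = 1)
  (ht₇ : ∀ (p : ℕ), p.Prime → p % 9 = 7 → (¬ ∃ x : ZMod p, x ^ 3 = 3) →
      ∀ (A B : WeierstrassCurve ℚ) [A.IsElliptic] [A.IsGloballyMinimal] [B.IsElliptic]
        [B.IsGloballyMinimal], (∃ C : VariableChange ℚ, C • B = cubeSumCurve (p : ℚ)) →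
        (∃ C : VariableChange ℚ, C • A = cubeSumCurve (3 * (p : ℚ) ^ 2)) →
        4 < Nat.card (AddCommGroup.primaryComponent B.sha 2) *
            Nat.card (AddCommGroup.primaryComponent A.sha 2) →
        ∃ qB qA : ℚ, shaAn B = (qB : ℂ) ∧ shaAn A = (qA : ℂ) ∧ qB * qA ≠ 0 ∧
          (padicValNat 2 (Nat.card (AddCommGroup.primaryComponent B.sha 2)) : ℤ) +
              (padicValNat 2 (Nat.card (AddCommGroup.primaryComponent A.sha 2)) : ℤ) ≤
            padicValRat 2 (qB * qA))

include hF hK2₇ in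
/-- **The `p ≡ 7 (9)` first layer + THEOREM C are SUFFICIENT for (K3-7)'s conclusion at every
pair with `#Ш(B)[2^∞]·#Ш(A)[2^∞] ≤ 4`**, granted `PublishedFactsTwoPlus` (THEOREM C, the cell's
fact-free `SylvesterTwoNonneg.HSYPointTwoDivisibleSevenModNine` ≡ crux 19802, supplies
`ord₂(qB·qA) = 2n ≥ 0`). [cite: HuShuYin2019, display (bsd) p. 12, p. 8] [cite: GrossLMS1991, Prop. 2.3] -/
theorem coupledUpperBoundSevenAt_of_thmC_of_firstLayer_of_card_mul_le_four
    (hC : SylvesterTwoNonneg.HSYPointTwoDivisibleSevenModNine) {p : ℕ} (hp : p.Prime)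
    (h7 : p % 9 = 7) (h3 : ¬ ∃ x : ZMod p, x ^ 3 = 3) (A B : WeierstrassCurve ℚ) [A.IsElliptic]
    [A.IsGloballyMinimal] [B.IsElliptic] [B.IsGloballyMinimal]
    (hB : ∃ C : VariableChange ℚ, C • B = cubeSumCurve (p : ℚ))
    (hA : ∃ C : VariableChange ℚ, C • A = cubeSumCurve (3 * (p : ℚ) ^ 2))
    (hle : Nat.card (AddCommGroup.primaryComponent B.sha 2) *
        Nat.card (AddCommGroup.primaryComponent A.sha 2) ≤ 4) :
    ∃ qB qA : ℚ, shaAn B = (qB : ℂ) ∧ shaAn A = (qA : ℂ) ∧ qB * qA ≠ 0 ∧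
      (padicValNat 2 (Nat.card (AddCommGroup.primaryComponent B.sha 2)) : ℤ) +
          (padicValNat 2 (Nat.card (AddCommGroup.primaryComponent A.sha 2)) : ℤ) ≤
        padicValRat 2 (qB * qA) := by
  obtain ⟨⟨hHSY, hCM0, hmod, -⟩, -⟩ := id hF
  obtain ⟨hfin, hfinA, -⟩ :=
    SylvesterTwoUpper.pair_shaAn_two hHSY hCM0 hmod hp (Or.inr h7) h3 A B hB hA
  obtain ⟨qB, qA, hqB, hqA, hne, n, hn⟩ :=
    even_rhs_of_facts_sevenModNine hF hC hp h7 h3 A B hB hA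
  exact pairBound_of_even_rhs_of_firstLayerAt_of_card_mul_le_four hqB hqA hne hn
    (hK2₇ p hp h7 h3 A B hB hA qB qA hqB hqA hne) hle

include hF hK2₇ ht₇ in
/-- **(K3-7) from THEOREM C + FIRST LAYER + TAIL**, granted `PublishedFactsTwoPlus` — with
`firstLayerSeven_of_coupledUpperBoundSeven` and p587423 an equivalence
«(K3-7) ⟺ THEOREM C ∧ FIRST LAYER ∧ TAIL». [cite: HuShuYin2019, display (bsd) p. 12]
[cite: McCallumLMS1991, Thm. 5.4] -/
theorem coupledUpperBoundSeven_of_thmC_of_firstLayer_of_tail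
    (hC : SylvesterTwoNonneg.HSYPointTwoDivisibleSevenModNine) :
    CoupledUpperBoundAtTwoSevenModNine := by
  intro p hp h7 h3 A B _ _ _ _ hB hA
  by_cases hle : Nat.card (AddCommGroup.primaryComponent B.sha 2) *
      Nat.card (AddCommGroup.primaryComponent A.sha 2) ≤ 4
  · exact coupledUpperBoundSevenAt_of_thmC_of_firstLayer_of_card_mul_le_four hF hK2₇ hC hp h7 h3
      A B hB hA hle
  · exact ht₇ p hp h7 h3 A B hB hA (not_le.mp hle)

/-! ## §4 The hand item 19229 from the factors -/

include hF hK2₄ ht₄ hK2₇ ht₇ in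
/-- **THE HAND ITEM 19229 `HeegnerIndexUpperAtTwoHSY` BY NAME ⟸ `PublishedFactsTwoPlus` +
THEOREM C + the two first layers + the two tails** (through p587423's
`heegnerIndexUpperAtTwoHSY_of_facts_of_coupledUpperBounds`). CONDITIONAL; credits nothing; every
factor is kernel-OPEN. [cite: HuShuYin2019, Cor. 4.4 and (bsd) p. 12]
[cite: GrossLMS1991, Prop. 2.3] [cite: McCallumLMS1991, Thm. 5.4] -/
theorem heegnerIndexUpperAtTwoHSY_of_factsPlus_of_thmC_of_firstLayers_of_tails
    (hC : SylvesterTwoNonneg.HSYPointTwoDivisibleSevenModNine) : HeegnerIndexUpperAtTwoHSY :=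
  SylvesterTwoResidualsSharp.heegnerIndexUpperAtTwoHSY_of_facts_of_coupledUpperBounds hF.1
    (coupledUpperBoundFour_of_firstLayer_of_tail hF hK2₄ ht₄)
    (coupledUpperBoundSeven_of_thmC_of_firstLayer_of_tail hF hK2₇ ht₇ hC)

end Split

end Summit.BirchSwinnertonDyer.BirchSwinnertonDyer.Theorems.SylvesterTwoFirstLayerSplit
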